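import Literature.MathematicalPhysics.QuantumFieldTheory.Balaban1983to89.B9Eq3126KFloorDiagonal
import Literature.MathematicalPhysics.QuantumFieldTheory.Balaban1983to89.B9Eq326OperatorTowerFlatExplicit

/-!
# `Balaban1983to89.B9Eq3126KFloorTowerDiagonal` — T. Bałaban, *Propagators for lattice gauge theories in a background field*, Commun. Math. Phys. **99**
# (1985) 389–434 [Balaban1985BackgroundPropagators] (3.126) p. 420, Thm 3.11 p. 416, (3.15)∕(3.26) pp. 393–395 at `k = n+1` AVERAGING LEVELS, with
# [Balaban1985Variational] (46) p. 285 and [Balaban1984PropagatorsI] (1.18) p. 20: **THE k-LEVEL PORT — at the flat background of the tower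
# `T_{L^{n+1}m} → ⋯ → T_m`, on print's diagonal `ηL^{n+1} = 1`, `c₀(L^{n+1})^d = c₁`, the letters `(Q_k(1)G_k(1)Q_k(1)†)⁻¹` and `H_{1,k}(1)` are bounded by
# `Ξ(d,a)` and `√(Ξ(d,a)∕γ)` — LEVEL-FREE, VOLUME-FREE, no operator bound of `Δ^{(k)}_a`** (the variational argument of `B9Eq3126KFloorFlat` RE-RUN at the
# tower letters through the OWNER's «flat tower = one step at block `L^{n+1}`» identities of `B9Eq316TowerFlatIsOneStep`)

statement-level skeleton of published theorems with citation tags; proofs where landed; nothing here is a claim about the Yang–Mills mass gap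

CITATION HEADER (lean-in-tree rule).  Audit cell `pub-balaban`, sub-cell `t4`, BINDER row NE9; filed by NE9 formalisation-swarm LEAF PROVER 02
(`b2b-balaban-t4-ne9-formalise-leaf-02`, gen 65).  Sources as `B9Eq3126KFloorFlat` ∕ `B9Eq3126KFloorDiagonal` (this lineage) and `B9Eq316TowerFlatIsOneStep`
(the NE9 owner t4-ne9-p1 g84): [Balaban1985BackgroundPropagators] pp. 393–395, 416, 420; [Balaban1985Variational] p. 285; [Balaban1984PropagatorsI] p. 20.

THE PRINT (verbatim).  [B9] p. 393, (3.15): the composite averagings `Q_j(U)`; p. 416, Thm 3.11: *«the operators Δ′_a, G′, (Q′G′²Q′*)⁻¹, Δ_a, G are positive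
definite»*; p. 420, (3.126): *«HB = GQ*(QGQ*)⁻¹B»*; [B11] p. 285 (46) with `B₀` uniform; [B5] (1.18) p. 20 (the flat multi-step averaging is the one-step
averaging at the product block).

WHY THIS FILE (cell context).  The NE9 owner's `B9Eq3126H1BoundTower` §3 bounds `H_{1,k}`, `(Q_kG_kQ_k†)⁻¹` with `C_H, C_K ∝ M_T² ∝ |η|⁻⁴` at every
lattice of the tower; `B9Eq3126KFloorDiagonal` (this lineage) shows that AT ONE STEP on the diagonal the variational currency gives `Ξ(d,a)`.  Print's
`k`-level flat letters ARE one-step letters at block `L^{n+1}` (`B9Eq316TowerFlatIsOneStep.QkW_one_eq_oneStep`, `principalLaplacek_one_eq_oneStep` — the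
OWNER g84), so the SAME test family, pulled back along the bond isometry `Φ`, inhabits `B9Eq3126GreenLettersVariational`'s `hux`∕`huu` at the TOWER
letters: the pairing is read through `Q_k(1) = Q^{(L^{n+1})}(1) ∘ Φ`, the energy through `Δ^{(k)}_a(1) = Φ⁻¹ ∘ Δ^{(L^{n+1})}_a(1) ∘ Φ`; the arithmetic is
`tent_ratio_le_diagonal` at block `L^{n+1}`.  With INTENT-8∕-9's closed `γ` (`B9Thm311SmallFieldCoercivityTowerClosed` ∕ `…LaplaceAkPositiveDiagonal`, or the
flat `coercive_laplaceAk_one_explicit`) every display but the windows is a function of `(d, a)`.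

WHAT IS PROVED (sorry-free; 0 `def`; [folklore] transport along the OWNER's identities + the previous files BY NAME; nothing of [B9]∕[B11] asserted).
* `laplaceAk_one_isSymmetric'` — `Δ^{(k)}_a(1)` is symmetric (flat transporters; no trace hypotheses).
* **`norm_KinvLatticeK_H1LatticeK_tower_one_le_diagonal`** — for the flat tower with `3 ≤ L^{n+1}`, `1 ≤ d`, `ηL^{n+1} = 1`, `c₀(L^{n+1})^d = c₁`, `a > 0`, a
  DISPLAYED coercivity constant `γ` of `Δ^{(k)}_a(1)` and ANY witnesses `hpos`, `hQ` of the tower letters: `‖KinvLatticeK hpos hQ y‖ ≤ Ξ(d,a)‖y‖` and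
  `‖H1LatticeK hpos hQ b‖ ≤ √(Ξ(d,a)∕γ)‖b‖`, `Ξ(d,a) = 180d·1215²(27²∕4²)^{d−1} + 2a(1215∕12)²(27²∕6²)^{d−1}`.
* **`norm_H1LatticeK_tower_one_le_diagonal_closed`** — the same with `γ` DISCHARGED by the OWNER's flat explicit constant
  (`B9Eq326OperatorTowerFlatExplicit.coercive_laplaceAk_one_explicit`: on the diagonal `γ = 1∕((d+1)·Cst d a)`): `‖H_{1,k}(1)b‖ ≤ √(Ξ(d,a)·((d+1)·Cst d a))·‖b‖`
  — a function of `(d, a)` and NOTHING else, for ANY `hpos`, `hQ`.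
HONEST SCOPE.  Flat background of the tower only (the windowed `U` is the FORM-perturbation sequel); crude constants; `γ` displayed; one-step regularity letters
at block `L^{n+1}` displayed as binders (their values are immaterial); NOT (46)'s kernel bound ∕ Thm 3.12; NOT NE9, NOT the route (cell pub-balaban: NE9 NOT
PRINTED ∕ NOT PROVED; «NE9 ⇐ the named binders»; row WALLED ON A MODEL (O-NE9-1; #5 UNRULED); spine PROVED 0∕9; rung (B)+1 on a finite T⁴ — NOT infinite volume,
NOT mass gap, NOT BetaPertH, NOT Clay).  HONEST DEPENDENCY (cell line): continuum YM on T⁴ ⇐ BetaPertH ∧ nine spine estimates (0/9 proved); BetaPertH ⇐ (D1) ∧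
(D4) ∧ CAP+tail; G-an2-4 gates asym, D1 and NE2/3/4.  NEW file importing `B9Eq3126KFloorDiagonal` (this lineage) and `B9Eq326OperatorTowerFlatExplicit` (OWNER g84; it carries `B9Eq316TowerFlatIsOneStep`);
nothing modified.  Net new unproved facts: 0.
-/

noncomputable section

open scoped InnerProductSpace ComplexConjugate BigOperators

namespace Literature.MathematicalPhysics.QuantumFieldTheory.Balaban1983to89.B9Eq3126KFloorTowerDiagonal

open B4Sect5Torus (TSite)
open B9SectCLatticeCarrier (Bond)
open B9Eq311L2Pairing (WL2)
open B9Eq319QprimeTorus (fineP offset blockCoord)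
open B9Eq315QTorus (perCfg cornerSite QtorusW laplaceAofBackground laplaceAofBackground_eq)
open B9Eq315QTower (towerP UlevOf)
open B7Prop1Explicit (U1 Wcx boxVec)
open B11Eq103H1Complex (BondL2K laplaceALatticeK H1LatticeK KinvLatticeK hadj_adjoint adjoint_injective_of_surjective)
open B9Eq310HessianOperator (adTransportW hessOp hessOp_one principalOpK_isSymmetric)
open B5Eq172HodgePositivity (hRS_one)
open B9Eq326OperatorAssembly (laplaceAofU_eq)
open B9Eq326OperatorTower (QkW RofUk RofUk_isSymmetric laplaceAk)
open B9Eq316TowerFlatIsOneStep (bondL2Cast inner_bondL2Cast QkW_one_eq_oneStep principalLaplacek_one_eq_oneStep)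

variable {d : ℕ} {𝔸 : Type*} [NormedRing 𝔸] [NormedAlgebra ℂ 𝔸] [CompleteSpace 𝔸] [NormOneClass 𝔸] [StarRing 𝔸] [StarModule ℂ 𝔸]
  (L : ℕ) [NeZero L] (m : Fin d → ℕ) [∀ i, NeZero (m i)] (n : ℕ) (hL : 1 ≤ L)
  {W : Type*} [NormedAddCommGroup W] [InnerProductSpace ℂ W] [FiniteDimensional ℂ W] (φ : W ≃ₗ[ℂ] 𝔸) {c₀ c₁ : ℝ} [Fact (0 < c₀)] [Fact (0 < c₁)]
  (η : ℝ) (τ : 𝔸 →ₗ[ℂ] ℂ)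
  (α : ℕ → ℝ) (hα1 : ∀ j, α j ≤ 1 / 64)
  (hU1 : ∀ (j : ℕ) (x : B7Prop1Explicit.Site d) (κ : Fin d),
    perCfg (towerP L m (j + 1)) (UlevOf L m (n + 1) (fun _ : Bond d (towerP L m (n + 1)) => (1 : 𝔸ˣ)) j) x κ ∈ U1 𝔸)
  (hreg : ∀ (j : ℕ) (y : TSite d (towerP L m j)) (κ : Fin d) (r : Fin d → Fin L),
    ‖((Wcx L (perCfg (towerP L m (j + 1)) (UlevOf L m (n + 1) (fun _ : Bond d (towerP L m (n + 1)) => (1 : 𝔸ˣ)) j)) (cornerSite L y) κ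
      (boxVec L r) : 𝔸ˣ) : 𝔸) - 1‖ ≤ α j)
  (hLk : 1 ≤ L ^ (n + 1)) {α' : ℝ} (hα1' : α' ≤ 1 / 64)
  (hU1' : ∀ (x : B7Prop1Explicit.Site d) (κ : Fin d),
    perCfg (fineP (L ^ (n + 1)) m) (fun _ : Bond d (fineP (L ^ (n + 1)) m) => (1 : 𝔸ˣ)) x κ ∈ U1 𝔸)
  (hreg' : ∀ (y : TSite d m) (κ : Fin d) (r : Fin d → Fin (L ^ (n + 1))),
    ‖((Wcx (L ^ (n + 1)) (perCfg (fineP (L ^ (n + 1)) m) (fun _ : Bond d (fineP (L ^ (n + 1)) m) => (1 : 𝔸ˣ))) (cornerSite (L ^ (n + 1)) y) κ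
      (boxVec (L ^ (n + 1)) r) : 𝔸ˣ) : 𝔸) - 1‖ ≤ α')
  (h : towerP L m (n + 1) = fineP (L ^ (n + 1)) m)

/-- **`Δ^{(k)}_a(1)` IS SYMMETRIC** (flat transporters are mutually adjoint, `Δ(1) = D*D`, `R_k(1)` an orthogonal projection) — the trace-free twin of
`B9Eq326OperatorTower.laplaceAk_isSymmetric` at `U = 1`. [folklore] [cite: Balaban1985BackgroundPropagators, (3.26) p.395, (3.10) p.392, (3.21) p.394] -/
theorem laplaceAk_one_isSymmetric' (a : ℝ) :
    (laplaceAk L m n φ η (fun _ : Bond d (towerP L m (n + 1)) => (1 : 𝔸ˣ)) hL α hα1 hU1 hreg τ (c₀ := c₀) (c₁ := c₁) a).IsSymmetric := by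
  have hc : conj (((η : ℂ))⁻¹) = ((η : ℂ))⁻¹ := by rw [map_inv₀, Complex.conj_ofReal]
  have hΔ : (hessOp φ η (fun _ : Bond d (towerP L m (n + 1)) => (1 : 𝔸ˣ)) τ (c₀ := c₀)).IsSymmetric := by
    rw [hessOp_one]; exact principalOpK_isSymmetric φ η _ (hRS_one φ)
  rw [laplaceAk]
  exact B11Eq103H1Complex.laplaceALatticeK_isSymmetric hc (hRS_one φ) hΔ (RofUk_isSymmetric L m n φ η _)

include hLk hα1' hU1' hreg' h in
/-- **THE k-LEVEL PORT ON PRINT's DIAGONAL**: at the flat background of the tower, with `3 ≤ L^{n+1}`, `1 ≤ d`, `ηL^{n+1} = 1`, `c₀(L^{n+1})^d = c₁`, `a > 0`,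
a DISPLAYED coercivity constant `γ` of `Δ^{(k)}_a(1)` and ANY witnesses `hpos`, `hQ`:
`‖(Q_k(1)G_k(1)Q_k(1)†)⁻¹y‖ ≤ Ξ(d,a)‖y‖` and `‖H_{1,k}(1)b‖ ≤ √(Ξ(d,a)∕γ)‖b‖` — the bond tent of block `L^{n+1}` pulled back along `Φ` is the test family
(`QkW_one_eq_oneStep` for the pairing, `principalLaplacek_one_eq_oneStep` + `inner_bondL2Cast` for the energy), `B9Eq3126GreenLettersVariational` at the tower
letters, `tent_ratio_le_diagonal` for the arithmetic.  LEVEL-FREE, VOLUME-FREE, no `‖Δ^{(k)}_a‖`. [folklore]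
[cite: Balaban1985BackgroundPropagators, (3.126) p.420, Thm 3.11 p.416, (3.15)–(3.16) p.393, (3.26) p.395; Balaban1985Variational, (45)–(46) p.285; Balaban1984PropagatorsI, (1.18) p.20] -/
theorem norm_KinvLatticeK_H1LatticeK_tower_one_le_diagonal (hL3 : 3 ≤ L ^ (n + 1)) (hd : 1 ≤ d) (hη : η * (((L ^ (n + 1) : ℕ) : ℝ)) = 1)
    (hw : c₀ * (((L ^ (n + 1) : ℕ) : ℝ)) ^ d = c₁) {a : ℝ} (ha : 0 < a) {γ : ℝ} (hγ : 0 < γ)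
    (hcoer : ∀ x : BondL2K ℂ d (towerP L m (n + 1)) c₀ W, γ * ‖x‖ ^ 2 ≤
      RCLike.re ⟪x, laplaceAk L m n φ η (fun _ : Bond d (towerP L m (n + 1)) => (1 : 𝔸ˣ)) hL α hα1 hU1 hreg τ (c₀ := c₀) (c₁ := c₁) a x⟫_ℂ)
    (hpos : ∀ x : BondL2K ℂ d (towerP L m (n + 1)) c₀ W, x ≠ 0 →
      0 < RCLike.re ⟪x, laplaceAk L m n φ η (fun _ : Bond d (towerP L m (n + 1)) => (1 : 𝔸ˣ)) hL α hα1 hU1 hreg τ (c₀ := c₀) (c₁ := c₁) a x⟫_ℂ)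
    (hQ : Function.Surjective (QkW L m n φ (fun _ : Bond d (towerP L m (n + 1)) => (1 : 𝔸ˣ)) hL α hα1 hU1 hreg (c₀ := c₀) (c₁ := c₁))) :
    (∀ y : BondL2K ℂ d m c₁ W, ‖KinvLatticeK hpos hQ y‖ ≤ (180 * (d : ℝ) * 1215 ^ 2 * ((27 : ℝ) ^ 2 / 4 ^ 2) ^ (d - 1) + 2 * a * (1215 / 12) ^ 2 * ((27 : ℝ) ^ 2 / 6 ^ 2) ^ (d - 1)) * ‖y‖) ∧
      ∀ b : BondL2K ℂ d m c₁ W, ‖H1LatticeK hpos hQ b‖ ≤ Real.sqrt ((180 * (d : ℝ) * 1215 ^ 2 * ((27 : ℝ) ^ 2 / 4 ^ 2) ^ (d - 1) + 2 * a * (1215 / 12) ^ 2 * ((27 : ℝ) ^ 2 / 6 ^ 2) ^ (d - 1)) / γ) * ‖b‖ := by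
  have hc₀ : 0 < c₀ := Fact.out
  have hc₁ : 0 < c₁ := Fact.out
  have hTs := laplaceAk_one_isSymmetric' L m n hL φ η τ α hα1 hU1 hreg (c₀ := c₀) (c₁ := c₁) a
  -- the three numbers of the tent at block `L^{n+1}`
  obtain ⟨hB, hAB, hS⟩ := B9Eq3126KFloorDiagonal.tent_numbers_bounds (d := d) (L ^ (n + 1)) hL3
  have hL0 : (0 : ℝ) < ((L ^ (n + 1) : ℕ) : ℝ) := by exact_mod_cast (by omega : 0 < L ^ (n + 1))
  have hβ : 0 < ((((L ^ (n + 1) : ℕ) : ℝ) ^ (d + 1))⁻¹ * ((∑ k ∈ Finset.range (L ^ (n + 1)), (k : ℝ) * ((((L ^ (n + 1) : ℕ) : ℝ)) - 1 - k)) ^ (d - 1) *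
          ∑ k ∈ Finset.range (L ^ (n + 1)), ∑ i ∈ Finset.range (L ^ (n + 1) - k), ((k + i : ℕ) : ℝ) ^ 2 * ((((L ^ (n + 1) : ℕ) : ℝ)) - 1 - ((k + i : ℕ) : ℝ)))) -
      ((((L ^ (n + 1) : ℕ) : ℝ) ^ (d + 1))⁻¹ * ((∑ k ∈ Finset.range (L ^ (n + 1)), (k : ℝ) * ((((L ^ (n + 1) : ℕ) : ℝ)) - 1 - k)) ^ (d - 1) *
          ∑ k ∈ Finset.range (L ^ (n + 1)), ∑ t ∈ Finset.range k, (t : ℝ) ^ 2 * ((((L ^ (n + 1) : ℕ) : ℝ)) - 1 - t))) :=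
    lt_of_lt_of_le (by positivity) hAB
  -- the test family: the bond tent of block `L^{n+1}`, pulled back along `Φ`
  have hux : ∀ ψ : BondL2K ℂ d m c₁ W,
      (((((L ^ (n + 1) : ℕ) : ℝ) ^ (d + 1))⁻¹ * ((∑ k ∈ Finset.range (L ^ (n + 1)), (k : ℝ) * ((((L ^ (n + 1) : ℕ) : ℝ)) - 1 - k)) ^ (d - 1) *
          ∑ k ∈ Finset.range (L ^ (n + 1)), ∑ i ∈ Finset.range (L ^ (n + 1) - k), ((k + i : ℕ) : ℝ) ^ 2 * ((((L ^ (n + 1) : ℕ) : ℝ)) - 1 - ((k + i : ℕ) : ℝ)))) -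
        ((((L ^ (n + 1) : ℕ) : ℝ) ^ (d + 1))⁻¹ * ((∑ k ∈ Finset.range (L ^ (n + 1)), (k : ℝ) * ((((L ^ (n + 1) : ℕ) : ℝ)) - 1 - k)) ^ (d - 1) *
          ∑ k ∈ Finset.range (L ^ (n + 1)), ∑ t ∈ Finset.range k, (t : ℝ) ^ 2 * ((((L ^ (n + 1) : ℕ) : ℝ)) - 1 - t)))) * ‖ψ‖ ^ 2 ≤
      RCLike.re ⟪QkW L m n φ (fun _ : Bond d (towerP L m (n + 1)) => (1 : 𝔸ˣ)) hL α hα1 hU1 hreg (c₀ := c₀) (c₁ := c₁)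
        ((bondL2Cast ℂ h).symm
          ((WL2.equiv ℂ (fun _ : Bond d (fineP (L ^ (n + 1)) m) => c₀) W).symm
          (fun b => (((((offset (L ^ (n + 1)) m b.1 b.2 : ℕ) : ℝ) ^ 2 * (((L ^ (n + 1) : ℕ) : ℝ) - 1 - (offset (L ^ (n + 1)) m b.1 b.2 : ℕ))) *
              ∏ ν ∈ Finset.univ.erase b.2, (((offset (L ^ (n + 1)) m b.1 ν : ℕ) : ℝ) * (((L ^ (n + 1) : ℕ) : ℝ) - 1 - (offset (L ^ (n + 1)) m b.1 ν : ℕ))) : ℝ) : ℂ) •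
            WL2.equiv ℂ (fun _ : Bond d m => c₁) W ψ (blockCoord (L ^ (n + 1)) m b.1, b.2)))), ψ⟫_ℂ := fun ψ => by
    rw [QkW_one_eq_oneStep L m n hL φ α hα1 hU1 hreg hLk hα1' hU1' hreg' h, LinearMap.comp_apply, LinearEquiv.coe_toLinearMap,
      LinearEquiv.apply_symm_apply]
    exact B9Eq3126KFloorFlat.re_inner_QtorusW_one_tent_ge (L ^ (n + 1)) m hLk hα1' hU1' hreg' φ (c₀ := c₀) (c₁ := c₁) ψ
  have huu : ∀ ψ : BondL2K ℂ d m c₁ W,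
      RCLike.re ⟪(bondL2Cast ℂ h).symm
          ((WL2.equiv ℂ (fun _ : Bond d (fineP (L ^ (n + 1)) m) => c₀) W).symm
          (fun b => (((((offset (L ^ (n + 1)) m b.1 b.2 : ℕ) : ℝ) ^ 2 * (((L ^ (n + 1) : ℕ) : ℝ) - 1 - (offset (L ^ (n + 1)) m b.1 b.2 : ℕ))) *
              ∏ ν ∈ Finset.univ.erase b.2, (((offset (L ^ (n + 1)) m b.1 ν : ℕ) : ℝ) * (((L ^ (n + 1) : ℕ) : ℝ) - 1 - (offset (L ^ (n + 1)) m b.1 ν : ℕ))) : ℝ) : ℂ) •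
            WL2.equiv ℂ (fun _ : Bond d m => c₁) W ψ (blockCoord (L ^ (n + 1)) m b.1, b.2))),
        laplaceAk L m n φ η (fun _ : Bond d (towerP L m (n + 1)) => (1 : 𝔸ˣ)) hL α hα1 hU1 hreg τ (c₀ := c₀) (c₁ := c₁) a
          ((bondL2Cast ℂ h).symm
            ((WL2.equiv ℂ (fun _ : Bond d (fineP (L ^ (n + 1)) m) => c₀) W).symm
          (fun b => (((((offset (L ^ (n + 1)) m b.1 b.2 : ℕ) : ℝ) ^ 2 * (((L ^ (n + 1) : ℕ) : ℝ) - 1 - (offset (L ^ (n + 1)) m b.1 b.2 : ℕ))) *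
              ∏ ν ∈ Finset.univ.erase b.2, (((offset (L ^ (n + 1)) m b.1 ν : ℕ) : ℝ) * (((L ^ (n + 1) : ℕ) : ℝ) - 1 - (offset (L ^ (n + 1)) m b.1 ν : ℕ))) : ℝ) : ℂ) •
            WL2.equiv ℂ (fun _ : Bond d m => c₁) W ψ (blockCoord (L ^ (n + 1)) m b.1, b.2))))⟫_ℂ ≤
      (‖((η : ℂ))⁻¹‖ ^ 2 * (6 * (((L ^ (n + 1) : ℕ) : ℝ)) ^ 2 * ((((L ^ (n + 1) : ℕ) : ℝ)) ^ 2 / 4) ^ (d - 1)) ^ 2 * (5 * (d : ℝ)) *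
      (c₀ * (((L ^ (n + 1) : ℕ) : ℝ)) ^ d / c₁) +
        a * (2 * (((((L ^ (n + 1) : ℕ) : ℝ) ^ (d + 1))⁻¹ * ((∑ k ∈ Finset.range (L ^ (n + 1)), (k : ℝ) * ((((L ^ (n + 1) : ℕ) : ℝ)) - 1 - k)) ^ (d - 1) *
          ∑ k ∈ Finset.range (L ^ (n + 1)), ∑ i ∈ Finset.range (L ^ (n + 1) - k), ((k + i : ℕ) : ℝ) ^ 2 * ((((L ^ (n + 1) : ℕ) : ℝ)) - 1 - ((k + i : ℕ) : ℝ)))) ^ 2 +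
          ((((L ^ (n + 1) : ℕ) : ℝ) ^ (d + 1))⁻¹ * ((∑ k ∈ Finset.range (L ^ (n + 1)), (k : ℝ) * ((((L ^ (n + 1) : ℕ) : ℝ)) - 1 - k)) ^ (d - 1) *
          ∑ k ∈ Finset.range (L ^ (n + 1)), ∑ t ∈ Finset.range k, (t : ℝ) ^ 2 * ((((L ^ (n + 1) : ℕ) : ℝ)) - 1 - t))) ^ 2))) * ‖ψ‖ ^ 2 := fun ψ => by
    rw [laplaceAk, hessOp_one, principalLaplacek_one_eq_oneStep L m n hL φ η α hα1 hU1 hreg hLk hα1' hU1' hreg' h a, LinearMap.comp_apply,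
      LinearMap.comp_apply, LinearEquiv.coe_toLinearMap, LinearEquiv.coe_toLinearMap, LinearEquiv.apply_symm_apply,
      ← inner_bondL2Cast ℂ h ((bondL2Cast ℂ h).symm _), LinearEquiv.apply_symm_apply, LinearEquiv.apply_symm_apply,
      ← hessOp_one (τ := τ), ← laplaceAofU_eq, ← laplaceAofBackground_eq]
    exact B9Eq3126KFloorFlat.re_inner_laplaceAofBackground_one_tent_le (L ^ (n + 1)) m hLk hα1' hU1' hreg' φ τ η (c₀ := c₀) (c₁ := c₁) ha.le ψ
  -- `M_u > 0`
  have hA : 0 < ((((L ^ (n + 1) : ℕ) : ℝ) ^ (d + 1))⁻¹ * ((∑ k ∈ Finset.range (L ^ (n + 1)), (k : ℝ) * ((((L ^ (n + 1) : ℕ) : ℝ)) - 1 - k)) ^ (d - 1) *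
          ∑ k ∈ Finset.range (L ^ (n + 1)), ∑ i ∈ Finset.range (L ^ (n + 1) - k), ((k + i : ℕ) : ℝ) ^ 2 * ((((L ^ (n + 1) : ℕ) : ℝ)) - 1 - ((k + i : ℕ) : ℝ)))) := lt_of_lt_of_le hβ (sub_le_self _ hB)
  have hMu : 0 < ‖((η : ℂ))⁻¹‖ ^ 2 * (6 * (((L ^ (n + 1) : ℕ) : ℝ)) ^ 2 * ((((L ^ (n + 1) : ℕ) : ℝ)) ^ 2 / 4) ^ (d - 1)) ^ 2 * (5 * (d : ℝ)) *
      (c₀ * (((L ^ (n + 1) : ℕ) : ℝ)) ^ d / c₁) +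
      a * (2 * (((((L ^ (n + 1) : ℕ) : ℝ) ^ (d + 1))⁻¹ * ((∑ k ∈ Finset.range (L ^ (n + 1)), (k : ℝ) * ((((L ^ (n + 1) : ℕ) : ℝ)) - 1 - k)) ^ (d - 1) *
          ∑ k ∈ Finset.range (L ^ (n + 1)), ∑ i ∈ Finset.range (L ^ (n + 1) - k), ((k + i : ℕ) : ℝ) ^ 2 * ((((L ^ (n + 1) : ℕ) : ℝ)) - 1 - ((k + i : ℕ) : ℝ)))) ^ 2 +
        ((((L ^ (n + 1) : ℕ) : ℝ) ^ (d + 1))⁻¹ * ((∑ k ∈ Finset.range (L ^ (n + 1)), (k : ℝ) * ((((L ^ (n + 1) : ℕ) : ℝ)) - 1 - k)) ^ (d - 1) *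
          ∑ k ∈ Finset.range (L ^ (n + 1)), ∑ t ∈ Finset.range k, (t : ℝ) ^ 2 * ((((L ^ (n + 1) : ℕ) : ℝ)) - 1 - t))) ^ 2)) := by
    have h1 : 0 ≤ ‖((η : ℂ))⁻¹‖ ^ 2 * (6 * (((L ^ (n + 1) : ℕ) : ℝ)) ^ 2 * ((((L ^ (n + 1) : ℕ) : ℝ)) ^ 2 / 4) ^ (d - 1)) ^ 2 * (5 * (d : ℝ)) *
      (c₀ * (((L ^ (n + 1) : ℕ) : ℝ)) ^ d / c₁) := by positivity
    nlinarith [sq_nonneg ((((L ^ (n + 1) : ℕ) : ℝ) ^ (d + 1))⁻¹ * ((∑ k ∈ Finset.range (L ^ (n + 1)), (k : ℝ) * ((((L ^ (n + 1) : ℕ) : ℝ)) - 1 - k)) ^ (d - 1) *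
          ∑ k ∈ Finset.range (L ^ (n + 1)), ∑ t ∈ Finset.range k, (t : ℝ) ^ 2 * ((((L ^ (n + 1) : ℕ) : ℝ)) - 1 - t))), mul_pos ha (pow_pos hA 2)]
  have key := B9Eq3126KFloorDiagonal.tent_ratio_le_diagonal (c₀ := c₀) (c₁ := c₁) (L ^ (n + 1)) η hL3 hd hη hw ha.le hB hAB hS
  refine ⟨fun y => ?_, fun b => ?_⟩
  · have hK := B9Eq3126GreenLettersVariational.norm_KinvK_le_of_test (𝕜 := ℂ) hpos hadj_adjoint (adjoint_injective_of_surjective _ hQ) hTs hMu hβ hux huu y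
    exact hK.trans (mul_le_mul_of_nonneg_right key (norm_nonneg _))
  · have hH := B9Eq3126GreenLettersVariational.norm_H1K_le_of_test (𝕜 := ℂ) hpos hadj_adjoint (adjoint_injective_of_surjective _ hQ) hγ hcoer hTs hMu hβ
      hux huu b
    refine hH.trans (mul_le_mul_of_nonneg_right (Real.sqrt_le_sqrt ?_) (norm_nonneg _))
    rw [mul_comm γ, ← div_div]
    exact div_le_div_of_nonneg_right key hγ.le

include hLk hα1' hU1' hreg' h in
/-- **FULLY CLOSED AT THE FLAT TOWER ON THE DIAGONAL**: `‖H_{1,k}(1)b‖ ≤ √(Ξ(d,a)·((d+1)·Cst d a))·‖b‖` — the previous bound with the coercivity constant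
DISCHARGED by the OWNER's `coercive_laplaceAk_one_explicit` (`γ = γ(d,a″)(ηL^{n+1})⁻²` with `a″ = a·c₁(ηL^{n+1})²∕(c₀(L^{n+1})^d) = a` and `(ηL^{n+1})⁻² = 1` at
print's point); `η ≠ 0` follows from `ηL^{n+1} = 1`.  For ANY witnesses `hpos`, `hQ` (they exist: `rePosDef_of_coercive`, `QkW_surjective`). [folklore]
[cite: Balaban1985BackgroundPropagators, (3.126) p.420, Thm 3.11 p.416; Balaban1984PropagatorsI, Prop. 1.1 (1.90) p.33; Balaban1985Variational, (46) p.285] -/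
theorem norm_H1LatticeK_tower_one_le_diagonal_closed (hL3 : 3 ≤ L ^ (n + 1)) (hd : 1 ≤ d) (hη : η * (((L ^ (n + 1) : ℕ) : ℝ)) = 1)
    (hw : c₀ * (((L ^ (n + 1) : ℕ) : ℝ)) ^ d = c₁) {a : ℝ} (ha : 0 < a)
    (hpos : ∀ x : BondL2K ℂ d (towerP L m (n + 1)) c₀ W, x ≠ 0 →
      0 < RCLike.re ⟪x, laplaceAk L m n φ η (fun _ : Bond d (towerP L m (n + 1)) => (1 : 𝔸ˣ)) hL α hα1 hU1 hreg τ (c₀ := c₀) (c₁ := c₁) a x⟫_ℂ)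
    (hQ : Function.Surjective (QkW L m n φ (fun _ : Bond d (towerP L m (n + 1)) => (1 : 𝔸ˣ)) hL α hα1 hU1 hreg (c₀ := c₀) (c₁ := c₁)))
    (b : BondL2K ℂ d m c₁ W) :
    ‖H1LatticeK hpos hQ b‖ ≤ Real.sqrt ((180 * (d : ℝ) * 1215 ^ 2 * ((27 : ℝ) ^ 2 / 4 ^ 2) ^ (d - 1) + 2 * a * (1215 / 12) ^ 2 * ((27 : ℝ) ^ 2 / 6 ^ 2) ^ (d - 1)) * ((d + 1 : ℝ) * B5Prop11Plancherel.Cst d a)) * ‖b‖ := by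
  have hc₀ : 0 < c₀ := Fact.out
  have hc₁ : 0 < c₁ := Fact.out
  have hLpow : (((L ^ (n + 1) : ℕ) : ℝ)) = (L : ℝ) ^ (n + 1) := by push_cast; ring
  have hηL : η * (L : ℝ) ^ (n + 1) = 1 := by rw [← hLpow]; exact hη
  have hη0 : η ≠ 0 := by
    intro h0; rw [h0, zero_mul] at hηL; exact zero_ne_one hηL
  have hw' : c₀ * ((L : ℝ) ^ (n + 1)) ^ d = c₁ := by rw [← hLpow]; exact hw
  -- the OWNER's explicit flat constant, read at print's point
  have ha'' : a * c₁ * (η * (L : ℝ) ^ (n + 1)) ^ 2 / (c₀ * ((L : ℝ) ^ (n + 1)) ^ d) = a := by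
    rw [hηL, hw', one_pow, mul_one, mul_div_assoc, div_self hc₁.ne', mul_one]
  have hC1 : (1 : ℝ) ≤ B5Prop11Plancherel.Cst d a := B5Prop11Lower.one_le_Cst _
  have hγ : 0 < 1 / ((d + 1 : ℝ) * B5Prop11Plancherel.Cst d a) := by positivity
  have hcoer : ∀ x : BondL2K ℂ d (towerP L m (n + 1)) c₀ W, 1 / ((d + 1 : ℝ) * B5Prop11Plancherel.Cst d a) * ‖x‖ ^ 2 ≤
      RCLike.re ⟪x, laplaceAk L m n φ η (fun _ : Bond d (towerP L m (n + 1)) => (1 : 𝔸ˣ)) hL α hα1 hU1 hreg τ (c₀ := c₀) (c₁ := c₁) a x⟫_ℂ := by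
    intro x
    have key := B9Eq326OperatorTowerFlatExplicit.coercive_laplaceAk_one_explicit L m n hL φ (c₀ := c₀) (c₁ := c₁) α hα1 hU1 hreg hη0 ha τ x
    rw [ha'', hηL, inv_one, one_pow, mul_one] at key
    exact key
  obtain ⟨-, hH⟩ := norm_KinvLatticeK_H1LatticeK_tower_one_le_diagonal L m n hL φ η τ α hα1 hU1 hreg hLk hα1' hU1' hreg' h hL3 hd hη hw ha hγ hcoer
    hpos hQ
  refine (hH b).trans (le_of_eq ?_)
  congr 2
  rw [div_div_eq_mul_div, div_one]

end Literature.MathematicalPhysics.QuantumFieldTheory.Balaban1983to89.B9Eq3126KFloorTowerDiagonal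

end
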